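/-
Copyright: b2b-lace packet (tail-bound analyst seat, gen 7).  [FvdH17] §5.1 / §6.1, proof of Lemma 5.2, "Case a = 1":
the RE-ROUTING step that lets the open class-1 bond `{u,w}` itself serve as the (bond-disjoint) witness of the line
`{w ↔ u}` of the "triangle + pendant" pattern — the deterministic input of the letters with an underlined index `1̲`
(`𝓑_{1̲,3}`, `𝓣_{1,1̲,1}`, `𝓣_{1̲,1,0}`, …).  LEMMAS §25 leaf X1-rr.  No named fact; no numeral; no dimension.
-/
import Literature.Probability.FitznerVanDerHofstad2017.NobleLastSausageOffA
import Literature.Probability.FitznerVanDerHofstad2017.NobleCodingLevelOne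
import Literature.Probability.FitznerVanDerHofstad2017.NobleCodingLevelZero
import HarnessLib

/-!
# [FvdH17] §6.1 — re-routing the lines of a triangle with a pendant line onto an open class-1 bond

CITATION HEADER (PLACEMENT v2). This module is part of a certified REPRODUCTION of:
R. Fitzner, R. van der Hofstad, *Mean-field behavior for nearest-neighbor percolation in d > 10*,
Electron. J. Probab. 22 (2017), no. 43 [FvdH17], §5.1 (arXiv:1506.07977v2 p. 46) and §6.1, proof of Lemma 5.2
(v2 p. 58, displays (6.6)–(6.7)).  Origin: build `lace` (host summit CriticalPhenomena), tail-bound analyst seat.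

THE PRINTED SENTENCES.  §5.1 (v2 p. 46, TeX l.9215–9216): "The length of a connection corresponds to the number of
bonds used by the shortest connected path of occupied bonds.  To obtain the infrared bound in `d ≥ 11` we distinguish
between the three cases `l_i = 0, 1` and `l_i ≥ 2`."  §6.1, proof of Lemma 5.2 (v2 p. 58, TeX l.9880–9888): "We
define `a = d_{C̃₀^{b₀}(0)}(b̲₀, w)` and `b = d_{C̃₁(x)}(t, z)` … **Case `a = 1`.** We conclude from `a = 1` that `u`
and `w` are neighbors, `2dD(u − w) = 1`, the bond `{u, w}` is occupied and `u ≠ 0`.  We split between `w = 0` and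
`w ≠ 0` to obtain the desired bound: `δ_{w,0} 𝓑_{1̲,3}(u,0) + 𝓣_{1,1̲,1}(u,w,0) = P^{S,1}(u,w)`." (6.7).  And for
the middle piece (v2 p. 59, TeX l.9912–9915, l.9926–9927): "**Case `a = 0, b = 1`.** We note that `u = w ≠ t, z` and
`2dD(z − t) = 1` and conclude `2dD(t − z) 𝓣_{1,1̲,0}(u − z, u + e_ι − z, t − z) ≤ Ā^{ι,0,1}(u,u,z,t)`." (6.12) …
"When `a = 1` and/or `b = 1`, we include the information that either `u, w` and/or `z, t` are neighbors into the
definition of `Ā^{ι,a,b}`.  Using the information and the parity of the lattice allows us to obtain improved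
numerical bounds on `Ā^{ι,a,b}`."

WHAT THE PRINT USES SILENTLY AND THIS MODULE PROVES.  In the letters with an underlined index (`𝓑_{1̲,3}`,
`𝓣_{1,1̲,1}`, `𝓣_{1̲,1,0}`, `𝓣_{1,1̲,0}`, `𝓢_{1̲,0,1̲,0}`, Def. 4.1 / App. B) the class-1 line IS the single occupied
bond, and the other lines of the diagram are bond-disjoint FROM THAT BOND.  The bounding event only provides SOME
family of pairwise bond-disjoint witnesses for the lines `{o ↔ u}, {o ↔ w}, {w ↔ u}, {w ↔ z}` (the level-0 pattern
of Fig. 12: `o = 0`, `u = b̲₀`, pendant `{w ↔ z}`; the level-1 pattern `{x ↔ z}, {x ↔ t}, {t ↔ z}, {t ↔ v}` is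
the same up to renaming `(o,u,w,z) ↦ (x,z,t,v)`), in which the witness of `{w ↔ u}` need not be the bond and the
other witnesses may USE the bond.  The re-routing lemma replaces them by pairwise bond-disjoint witnesses in which
the `w–u` witness is the bond `{u,w}` itself, every new witness lies inside the union of the old ones (the two
triangle lines inside the old triangle lines, the pendant inside the old pendant and the old `w–u` line), and the
pendant is UNCHANGED when it did not use the bond — so that the level-0 clause "inside `C̃₀ ∖ b₀`" and the level-1
off-`A` clause of `NobleLastSausageOffA` / the cross-level disjointness survive the re-routing.

* `LaceGraph.exists_first_edge_eq`, `LaceGraph.exists_last_edge_eq` — a walk splits at the FIRST / LAST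
  occurrence of a given edge (the prefix, resp. suffix, avoids it).  [folklore]
* **`LaceGraph.exists_reroute_onto_adj`** — the walk-level re-routing lemma in an arbitrary simple graph
  (case analysis on which of the three other walks contains the bond; splice the old `w–u` walk into it).
* `LaceGraph.exists_reroute_onto_adj'` — the same with the level-1 orientations (`W₄ : z → x`, `W₃ : t → x`,
  `W₂ : t → z`, `W₁ : v → t` of `exists_offA_theta_of_mem_laceE`), by reversing walks.
* **`exists_reroute_openConn`** — the witness-set form in the percolation vocabulary (`K ∈ openConn a b`, pairwise
  `Disjoint`), the currency of `eventFN` / `eventFNoff` and of the joint two-level event of LEMMAS §25 X1-j2;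
  `singleton_mem_openConn` — the bond `{s(w,u)}` witnesses `{w ↔ u}`.
* **`LaceCoding₀.exists_reroute`**, **`LaceCoding.exists_reroute`** — the CODING form: a level-`0` coding
  (`NobleCodingLevelZero.LaceCoding₀`, class `a = 1`: the bond `{w₀, b̲₀}` open in `ω ∖ b₀`) resp. a level-`1`
  coding (`NobleCodingLevelOne.LaceCoding`, class `b = 1`: the bond `{t, z}` open, `z ≠ t`) can be replaced by
  one whose class-`1` line IS the one-bond walk, keeping the canonical clauses, the off-`A` clauses (level 1:
  `W₁` is unchanged because `z ∈ A`, `z ≠ t` keep the bond off `W₁`; the bond walk `t → z` meets `A` only in `z`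
  since `t ∉ A`, `LaceCoding.start_notMem`) and "inside the old walks".

NOT here: the length-class split itself (`NobleExactLengthLines`: `openConn = openConnEq 0 ∪ openConnEq 1 ∪
openConnGe 2`), the parity step "the other line of `0 ⇔ u` has length `≥ 3`" (`NobleBoundsN0` §B), any measure,
any letter, any numeral.  Everything is deterministic graph theory ([folklore] tags); the module docstring records
the use made of it in [FvdH17].

## References
* [FvdH17] R. Fitzner, R. van der Hofstad, EJP 22 (2017) no. 43; arXiv:1506.07977v2 — §5.1 (v2 p. 46), §6.1 proof
  of Lemma 5.2, Case `a = 1` (v2 p. 58, (6.6)–(6.7)), the nine cases `(a,b)` and the sentence "When `a = 1`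
  and/or `b = 1` …" (v2 p. 59, (6.9)–(6.14)), Fig. 12 (v2 p. 58),
  Def. 4.1 (repulsive diagrams, v2 p. 34), App. B (v2 pp. 73–78).
* [HvdH17] M. Heydenreich, R. van der Hofstad, *Progress in high-dimensional percolation and random graphs*,
  Springer 2017 — Def. 6.2–6.3 (disjoint occurrence by bond-disjoint witnesses).
-/

namespace Literature.Barriers.CriticalPhenomena

namespace LaceGraph

open _root_.SimpleGraph

variable {V : Type*} {G : _root_.SimpleGraph V}

/-- **First occurrence of an edge.** If `e` is an edge of the walk `p`, then `p = q₁ ++ (a → b) ++ q₂` with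
`s(a,b) = e` and `e ∉ q₁.edges`. [folklore] -/
theorem exists_first_edge_eq {u v : V} (p : G.Walk u v) {e : Sym2 V} (he : e ∈ p.edges) :
    ∃ (a b : V) (q₁ : G.Walk u a) (h : G.Adj a b) (q₂ : G.Walk b v),
      p = q₁.append (Walk.cons h q₂) ∧ s(a, b) = e ∧ e ∉ q₁.edges := by
  obtain ⟨a, b, q₁, h, q₂, hp, hab, hmin⟩ := exists_first_edge (· = e) p ⟨e, he, rfl⟩
  exact ⟨a, b, q₁, h, q₂, hp, hab, fun h' => hmin e h' rfl⟩

/-- **Last occurrence of an edge.** If `e` is an edge of the walk `p`, then `p = q₁ ++ (a → b) ++ q₂` with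
`s(a,b) = e` and `e ∉ q₂.edges`. [folklore] -/
theorem exists_last_edge_eq {u v : V} (p : G.Walk u v) {e : Sym2 V} (he : e ∈ p.edges) :
    ∃ (a b : V) (q₁ : G.Walk u a) (h : G.Adj a b) (q₂ : G.Walk b v),
      p = q₁.append (Walk.cons h q₂) ∧ s(a, b) = e ∧ e ∉ q₂.edges := by
  have he' : e ∈ p.reverse.edges := by
    rw [Walk.edges_reverse]; exact List.mem_reverse.2 he
  obtain ⟨b, a, r₁, h, r₂, hp, hab, hmin⟩ := exists_first_edge_eq p.reverse he'
  refine ⟨a, b, r₂.reverse, h.symm, r₁.reverse, ?_, by rw [Sym2.eq_swap]; exact hab, ?_⟩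
  · have hrev := congrArg Walk.reverse hp
    rw [Walk.reverse_reverse] at hrev
    rw [hrev, Walk.reverse_append, Walk.reverse_cons, ← Walk.append_assoc, Walk.cons_append, Walk.nil_append]
  · rw [Walk.edges_reverse]
    exact fun h' => hmin (List.mem_reverse.1 h')

/-- **Re-routing onto an open class-1 bond** ("triangle + pendant" pattern; [FvdH17] §6.1, proof of Lemma 5.2,
Case `a = 1` / `b = 1`, used silently).  In a simple graph let `P₁ : o → u`, `P₂ : o → w`, `P₃ : w → u`,
`P₄ : w → z` be pairwise edge-disjoint walks.  Then there are pairwise edge-disjoint walks `Q₁ : o → u`,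
`Q₂ : o → w`, `Q₄ : w → z` avoiding the edge `s(w,u)` (so that, when `w ∼ u`, together with the one-edge walk
`w → u` they are again four pairwise edge-disjoint walks for the same pattern), with every edge / vertex of `Q₁, Q₂`
an edge / vertex of `P₁, P₂` or `P₃`, every edge / vertex of `Q₄` an edge / vertex of `P₄` or `P₃`, and `Q₄ = P₄`
whenever `P₄` avoids `s(w,u)`.  Proof: at most one of `P₁, P₂, P₄` contains the edge; split `P₁` (resp. `P₂`) at
its first occurrence and keep the prefix, supplying the other triangle line as `P₂ ++ P₃` (resp. `P₁ ++ P₃⁻¹`) if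
the prefix ends at the wrong vertex; split `P₄` at its last occurrence and keep the suffix, prefixed by `P₃` if it
starts at `u`. [folklore] -/
theorem exists_reroute_onto_adj {o u w z : V} (P₁ : G.Walk o u) (P₂ : G.Walk o w) (P₃ : G.Walk w u)
    (P₄ : G.Walk w z) (h₁₂ : List.Disjoint P₁.edges P₂.edges) (h₁₃ : List.Disjoint P₁.edges P₃.edges)
    (h₁₄ : List.Disjoint P₁.edges P₄.edges) (h₂₃ : List.Disjoint P₂.edges P₃.edges)
    (h₂₄ : List.Disjoint P₂.edges P₄.edges) (h₃₄ : List.Disjoint P₃.edges P₄.edges) :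
    ∃ (Q₁ : G.Walk o u) (Q₂ : G.Walk o w) (Q₄ : G.Walk w z),
      s(w, u) ∉ Q₁.edges ∧ s(w, u) ∉ Q₂.edges ∧ s(w, u) ∉ Q₄.edges ∧
      List.Disjoint Q₁.edges Q₂.edges ∧ List.Disjoint Q₁.edges Q₄.edges ∧ List.Disjoint Q₂.edges Q₄.edges ∧
      (∀ e ∈ Q₁.edges, e ∈ P₁.edges ∨ e ∈ P₂.edges ∨ e ∈ P₃.edges) ∧
      (∀ e ∈ Q₂.edges, e ∈ P₁.edges ∨ e ∈ P₂.edges ∨ e ∈ P₃.edges) ∧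
      (∀ e ∈ Q₄.edges, e ∈ P₄.edges ∨ e ∈ P₃.edges) ∧
      (∀ y ∈ Q₁.support, y ∈ P₁.support ∨ y ∈ P₂.support ∨ y ∈ P₃.support) ∧
      (∀ y ∈ Q₂.support, y ∈ P₁.support ∨ y ∈ P₂.support ∨ y ∈ P₃.support) ∧
      (∀ y ∈ Q₄.support, y ∈ P₄.support ∨ y ∈ P₃.support) ∧
      (s(w, u) ∉ P₄.edges → Q₄ = P₄) := by
  classical
  by_cases hb₁ : s(w, u) ∈ P₁.edges
  · -- the edge lies on `P₁`; hence not on `P₂, P₃, P₄`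
    have hb₂ : s(w, u) ∉ P₂.edges := fun h => h₁₂ hb₁ h
    have hb₃ : s(w, u) ∉ P₃.edges := fun h => h₁₃ hb₁ h
    have hb₄ : s(w, u) ∉ P₄.edges := fun h => h₁₄ hb₁ h
    obtain ⟨a, b, q₁, h, q₂, hp, hab, hmin⟩ := exists_first_edge_eq P₁ hb₁
    subst hp
    simp only [Walk.edges_append, Walk.edges_cons, List.disjoint_append_left, List.disjoint_cons_left] at h₁₂ h₁₃ h₁₄
    rcases Sym2.eq_iff.1 hab with ⟨rfl, rfl⟩ | ⟨rfl, rfl⟩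
    · -- traversed `w → u`: the prefix `q₁ : o → w` is the new `o–w` line, `P₂ ++ P₃` the new `o–u` line
      refine ⟨P₂.append P₃, q₁, P₄, ?_, hmin, hb₄, ?_, ?_, h₁₄.1, ?_, ?_, fun e he => Or.inl he, ?_, ?_,
        fun y hy => Or.inl hy, fun _ => rfl⟩
      · rw [Walk.edges_append, List.mem_append]; exact fun h' => h'.elim hb₂ hb₃
      · rw [Walk.edges_append, List.disjoint_append_left]; exact ⟨h₁₂.1.symm, h₁₃.1.symm⟩
      · rw [Walk.edges_append, List.disjoint_append_left]; exact ⟨h₂₄, h₃₄⟩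
      · intro e he
        rw [Walk.edges_append, List.mem_append] at he
        exact Or.inr he
      · intro e he
        exact Or.inl (by rw [Walk.edges_append]; exact List.mem_append.2 (Or.inl he))
      · intro y hy
        exact Or.inr ((Walk.mem_support_append_iff _ _).1 hy)
      · intro y hy
        exact Or.inl (Walk.support_subset_support_append_left _ _ hy)
    · -- traversed `u → w`: the prefix `q₁ : o → u` is the new `o–u` line
      refine ⟨q₁, P₂, P₄, hmin, hb₂, hb₄, h₁₂.1, h₁₄.1, h₂₄, ?_, fun e he => Or.inr (Or.inl he),
        fun e he => Or.inl he, ?_, fun y hy => Or.inr (Or.inl hy), fun y hy => Or.inl hy, fun _ => rfl⟩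
      · intro e he
        exact Or.inl (by rw [Walk.edges_append]; exact List.mem_append.2 (Or.inl he))
      · intro y hy
        exact Or.inl (Walk.support_subset_support_append_left _ _ hy)
  by_cases hb₂ : s(w, u) ∈ P₂.edges
  · -- the edge lies on `P₂`; hence not on `P₃, P₄`
    have hb₃ : s(w, u) ∉ P₃.edges := fun h => h₂₃ hb₂ h
    have hb₄ : s(w, u) ∉ P₄.edges := fun h => h₂₄ hb₂ h
    obtain ⟨a, b, q₁, h, q₂, hp, hab, hmin⟩ := exists_first_edge_eq P₂ hb₂
    subst hp
    simp only [Walk.edges_append, Walk.edges_cons, List.disjoint_append_left, List.disjoint_cons_left,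
      List.disjoint_append_right, List.disjoint_cons_right] at h₁₂ h₂₃ h₂₄
    rcases Sym2.eq_iff.1 hab with ⟨rfl, rfl⟩ | ⟨rfl, rfl⟩
    · -- traversed `w → u`: the prefix `q₁ : o → w` is the new `o–w` line
      refine ⟨P₁, q₁, P₄, hb₁, hmin, hb₄, h₁₂.1, h₁₄, h₂₄.1, fun e he => Or.inl he, ?_, fun e he => Or.inl he,
        fun y hy => Or.inl hy, ?_, fun y hy => Or.inl hy, fun _ => rfl⟩
      · intro e he
        exact Or.inr (Or.inl (by rw [Walk.edges_append]; exact List.mem_append.2 (Or.inl he)))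
      · intro y hy
        exact Or.inr (Or.inl (Walk.support_subset_support_append_left _ _ hy))
    · -- traversed `u → w`: the prefix `q₁ : o → u` is the new `o–u` line, `P₁ ++ P₃⁻¹` the new `o–w` line
      refine ⟨q₁, P₁.append P₃.reverse, P₄, hmin, ?_, hb₄, ?_, h₂₄.1, ?_, ?_, ?_, fun e he => Or.inl he, ?_, ?_,
        fun y hy => Or.inl hy, fun _ => rfl⟩
      · rw [Walk.edges_append, Walk.edges_reverse, List.mem_append, List.mem_reverse]
        exact fun h' => h'.elim hb₁ hb₃
      · rw [Walk.edges_append, Walk.edges_reverse, List.disjoint_append_right, List.disjoint_reverse_right]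
        exact ⟨h₁₂.1.symm, h₂₃.1⟩
      · rw [Walk.edges_append, Walk.edges_reverse, List.disjoint_append_left, List.disjoint_reverse_left]
        exact ⟨h₁₄, h₃₄⟩
      · intro e he
        exact Or.inr (Or.inl (by rw [Walk.edges_append]; exact List.mem_append.2 (Or.inl he)))
      · intro e he
        rw [Walk.edges_append, Walk.edges_reverse, List.mem_append, List.mem_reverse] at he
        exact he.elim Or.inl (fun h' => Or.inr (Or.inr h'))
      · intro y hy
        exact Or.inr (Or.inl (Walk.support_subset_support_append_left _ _ hy))
      · intro y hy
        rw [Walk.mem_support_append_iff, Walk.support_reverse, List.mem_reverse] at hy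
        exact hy.elim Or.inl (fun h' => Or.inr (Or.inr h'))
  by_cases hb₄ : s(w, u) ∈ P₄.edges
  · -- the edge lies on the pendant `P₄`; hence not on `P₃`
    have hb₃ : s(w, u) ∉ P₃.edges := fun h => h₃₄ h hb₄
    obtain ⟨a, b, q₁, h, q₂, hp, hab, hmin⟩ := exists_last_edge_eq P₄ hb₄
    subst hp
    simp only [Walk.edges_append, Walk.edges_cons, List.disjoint_append_right, List.disjoint_cons_right]
      at h₁₄ h₂₄ h₃₄
    rcases Sym2.eq_iff.1 hab with ⟨rfl, rfl⟩ | ⟨rfl, rfl⟩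
    · -- traversed `w → u`: the suffix `q₂ : u → z` prefixed by `P₃` is the new pendant
      refine ⟨P₁, P₂, P₃.append q₂, hb₁, hb₂, ?_, h₁₂, ?_, ?_, fun e he => Or.inl he, fun e he => Or.inr (Or.inl he),
        ?_, fun y hy => Or.inl hy, fun y hy => Or.inr (Or.inl hy), ?_, fun h' => ?_⟩
      · rw [Walk.edges_append, List.mem_append]; exact fun h' => h'.elim hb₃ hmin
      · rw [Walk.edges_append, List.disjoint_append_right]; exact ⟨h₁₃, h₁₄.2.2⟩
      · rw [Walk.edges_append, List.disjoint_append_right]; exact ⟨h₂₃, h₂₄.2.2⟩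
      · intro e he
        rw [Walk.edges_append, List.mem_append] at he
        refine he.elim (fun h' => Or.inr h') (fun h' => Or.inl ?_)
        rw [Walk.edges_append, Walk.edges_cons]
        exact List.mem_append.2 (Or.inr (List.mem_cons.2 (Or.inr h')))
      · intro y hy
        rw [Walk.mem_support_append_iff] at hy
        refine hy.elim (fun h' => Or.inr h') (fun h' => Or.inl ?_)
        exact Walk.support_subset_support_append_right _ _ (by rw [Walk.support_cons]; exact List.mem_cons.2 (Or.inr h'))
      · exact (h' (by
          rw [Walk.edges_append, Walk.edges_cons]
          exact List.mem_append.2 (Or.inr (List.mem_cons.2 (Or.inl rfl))))).elim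
    · -- traversed `u → w`: the suffix `q₂ : w → z` is the new pendant
      refine ⟨P₁, P₂, q₂, hb₁, hb₂, hmin, h₁₂, h₁₄.2.2, h₂₄.2.2, fun e he => Or.inl he, fun e he => Or.inr (Or.inl he),
        ?_, fun y hy => Or.inl hy, fun y hy => Or.inr (Or.inl hy), ?_, fun h' => ?_⟩
      · intro e he
        refine Or.inl ?_
        rw [Walk.edges_append, Walk.edges_cons]
        exact List.mem_append.2 (Or.inr (List.mem_cons.2 (Or.inr he)))
      · intro y hy
        exact Or.inl (Walk.support_subset_support_append_right _ _
          (by rw [Walk.support_cons]; exact List.mem_cons.2 (Or.inr hy)))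
      · exact (h' (by
          rw [Walk.edges_append, Walk.edges_cons]
          exact List.mem_append.2 (Or.inr (List.mem_cons.2 (Or.inl Sym2.eq_swap))))).elim
  · -- the edge lies on none of `P₁, P₂, P₄`: nothing to do
    exact ⟨P₁, P₂, P₄, hb₁, hb₂, hb₄, h₁₂, h₁₄, h₂₄, fun e he => Or.inl he, fun e he => Or.inr (Or.inl he),
      fun e he => Or.inl he, fun y hy => Or.inl hy, fun y hy => Or.inr (Or.inl hy), fun y hy => Or.inl hy,
      fun _ => rfl⟩


/-- **Re-routing, level-1 orientation** — `exists_reroute_onto_adj` for the four walks of the last-sausage coding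
`W₁ : v → t`, `W₂ : t → z`, `W₃ : t → x`, `W₄ : z → x` (`exists_offA_theta_of_mem_laceE`; [FvdH17] Fig. 12, §6.1
proof of Lemma 5.2 "Case `b = 1`": the bond `{t,z}` is occupied): pairwise edge-disjoint `W₁' : v → t`,
`W₃' : t → x`, `W₄' : z → x` avoiding `s(t,z)`, with `W₁'` inside `W₁, W₂` (and `W₁' = W₁` if `W₁` avoids the
bond — always the case under the off-`A` clause, since `z ∈ A` and `z ≠ t`), `W₃', W₄'` inside `W₂, W₃, W₄`.
Obtained from `exists_reroute_onto_adj` by reversing walks. [folklore] -/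
theorem exists_reroute_onto_adj' {v t z x : V} (W₁ : G.Walk v t) (W₂ : G.Walk t z) (W₃ : G.Walk t x)
    (W₄ : G.Walk z x) (h₁₂ : List.Disjoint W₁.edges W₂.edges) (h₁₃ : List.Disjoint W₁.edges W₃.edges)
    (h₁₄ : List.Disjoint W₁.edges W₄.edges) (h₂₃ : List.Disjoint W₂.edges W₃.edges)
    (h₂₄ : List.Disjoint W₂.edges W₄.edges) (h₃₄ : List.Disjoint W₃.edges W₄.edges) :
    ∃ (W₁' : G.Walk v t) (W₃' : G.Walk t x) (W₄' : G.Walk z x),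
      s(t, z) ∉ W₁'.edges ∧ s(t, z) ∉ W₃'.edges ∧ s(t, z) ∉ W₄'.edges ∧
      List.Disjoint W₁'.edges W₃'.edges ∧ List.Disjoint W₁'.edges W₄'.edges ∧ List.Disjoint W₃'.edges W₄'.edges ∧
      (∀ e ∈ W₁'.edges, e ∈ W₁.edges ∨ e ∈ W₂.edges) ∧
      (∀ e ∈ W₃'.edges, e ∈ W₂.edges ∨ e ∈ W₃.edges ∨ e ∈ W₄.edges) ∧
      (∀ e ∈ W₄'.edges, e ∈ W₂.edges ∨ e ∈ W₃.edges ∨ e ∈ W₄.edges) ∧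
      (∀ y ∈ W₁'.support, y ∈ W₁.support ∨ y ∈ W₂.support) ∧
      (∀ y ∈ W₃'.support, y ∈ W₂.support ∨ y ∈ W₃.support ∨ y ∈ W₄.support) ∧
      (∀ y ∈ W₄'.support, y ∈ W₂.support ∨ y ∈ W₃.support ∨ y ∈ W₄.support) ∧
      (s(t, z) ∉ W₁.edges → W₁' = W₁) := by
  have hr : ∀ {a b c c' : V} (p : G.Walk a b) (q : G.Walk c c'),
      List.Disjoint p.edges q.edges → List.Disjoint p.reverse.edges q.edges := by
    intro a b c c' p q h
    rw [Walk.edges_reverse]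
    exact List.disjoint_reverse_left.2 h
  have hr' : ∀ {a b c c' : V} (p : G.Walk a b) (q : G.Walk c c'),
      List.Disjoint p.edges q.edges → List.Disjoint p.edges q.reverse.edges := by
    intro a b c c' p q h
    rw [Walk.edges_reverse]
    exact List.disjoint_reverse_right.2 h
  obtain ⟨Q₁, Q₂, Q₄, hb₁, hb₂, hb₄, d₁₂, d₁₄, d₂₄, e₁, e₂, e₄, s₁, s₂, s₄, hfix⟩ :=
    exists_reroute_onto_adj (o := x) (u := z) (w := t) (z := v) W₄.reverse W₃.reverse W₂ W₁.reverse
      (hr _ _ (hr' _ _ h₃₄.symm)) (hr _ _ h₂₄.symm) (hr _ _ (hr' _ _ h₁₄.symm)) (hr _ _ h₂₃.symm)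
      (hr _ _ (hr' _ _ h₁₃.symm)) (hr' _ _ h₁₂.symm)
  have memr : ∀ {a b : V} (p : G.Walk a b) (e : Sym2 V), e ∈ p.reverse.edges ↔ e ∈ p.edges := by
    intro a b p e
    rw [Walk.edges_reverse, List.mem_reverse]
  have mems : ∀ {a b : V} (p : G.Walk a b) (y : V), y ∈ p.reverse.support ↔ y ∈ p.support := by
    intro a b p y
    rw [Walk.support_reverse, List.mem_reverse]
  refine ⟨Q₄.reverse, Q₂.reverse, Q₁.reverse, ?_, ?_, ?_, ?_, ?_, ?_, ?_, ?_, ?_, ?_, ?_, ?_, fun h' => ?_⟩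
  · rw [memr]; exact hb₄
  · rw [memr]; exact hb₂
  · rw [memr]; exact hb₁
  · exact hr _ _ (hr' _ _ d₂₄.symm)
  · exact hr _ _ (hr' _ _ d₁₄.symm)
  · exact hr _ _ (hr' _ _ d₁₂.symm)
  · intro e he
    rw [memr] at he
    rcases e₄ e he with h' | h'
    · exact Or.inl ((memr _ _).1 h')
    · exact Or.inr h'
  · intro e he
    rw [memr] at he
    rcases e₂ e he with h' | h' | h'
    · exact Or.inr (Or.inr ((memr _ _).1 h'))
    · exact Or.inr (Or.inl ((memr _ _).1 h'))
    · exact Or.inl h'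
  · intro e he
    rw [memr] at he
    rcases e₁ e he with h' | h' | h'
    · exact Or.inr (Or.inr ((memr _ _).1 h'))
    · exact Or.inr (Or.inl ((memr _ _).1 h'))
    · exact Or.inl h'
  · intro y hy
    rw [mems] at hy
    rcases s₄ y hy with h' | h'
    · exact Or.inl ((mems _ _).1 h')
    · exact Or.inr h'
  · intro y hy
    rw [mems] at hy
    rcases s₂ y hy with h' | h' | h'
    · exact Or.inr (Or.inr ((mems _ _).1 h'))
    · exact Or.inr (Or.inl ((mems _ _).1 h'))
    · exact Or.inl h'
  · intro y hy
    rw [mems] at hy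
    rcases s₁ y hy with h' | h' | h'
    · exact Or.inr (Or.inr ((mems _ _).1 h'))
    · exact Or.inr (Or.inl ((mems _ _).1 h'))
    · exact Or.inl h'
  · have h'' : s(t, z) ∉ W₁.reverse.edges := fun h => h' ((memr _ _).1 h)
    rw [hfix h'', Walk.reverse_reverse]

end LaceGraph

end Literature.Barriers.CriticalPhenomena

/-! ### The witness-set form (percolation vocabulary) -/

namespace Literature.Probability.FitznerVanDerHofstad2017

section Reroute

open Literature.Barriers.CriticalPhenomena Literature.Probability.Percolation
open _root_.SimpleGraph

variable {V : Type*}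

/-- An open walk of a sub-configuration `K ⊆ Ω` is an open walk of `Ω` with the same edges and vertices.
[folklore] -/
theorem exists_walk_openGraph_of_subset {K Ω : BondConfig V} (hKΩ : K ⊆ Ω) {a b : V}
    (W : (openGraph K).Walk a b) :
    ∃ W' : (openGraph Ω).Walk a b, W'.edges = W.edges ∧ W'.support = W.support :=
  ⟨W.transfer (openGraph Ω) fun _ he =>
      _root_.SimpleGraph.edgeSet_mono (openGraph_mono hKΩ) (W.edges_subset_edgeSet he),
    Walk.edges_transfer _ _, Walk.support_transfer _ _⟩

/-- A single bond witnesses the connection of its two distinct endpoints: `{s(w,u)} ∈ {w ↔ u}`. [folklore] -/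
theorem singleton_mem_openConn {w u : V} (hwu : w ≠ u) :
    ({s(w, u)} : Set (Sym2 V)) ∈ (openConn w u : Set (BondConfig V)) :=
  _root_.SimpleGraph.Adj.reachable ((openGraph_adj _ w u).2 ⟨Set.mem_singleton _, hwu⟩)

/-- **Re-routing onto an open class-1 bond, witness-set form** ([FvdH17] §6.1, proof of Lemma 5.2, Cases `a = 1`
/ `b = 1`; the deterministic input of the letters `𝓑_{1̲,3}`, `𝓣_{1,1̲,1}`, … of (6.6)–(6.7)).  Given pairwise
disjoint witnesses `K₁ ∈ {o ↔ u}`, `K₂ ∈ {o ↔ w}`, `K₃ ∈ {w ↔ u}`, `K₄ ∈ {w ↔ z}` of the "triangle + pendant"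
pattern, there are pairwise disjoint witnesses `K₁' ∈ {o ↔ u}`, `K₂' ∈ {o ↔ w}`, `K₄' ∈ {w ↔ z}` NOT
CONTAINING the bond `s(w,u)` — so that `K₁', K₂', {s(w,u)}, K₄'` are again pairwise disjoint witnesses of the four
lines as soon as `w ≠ u` (`singleton_mem_openConn`) — with `K₁', K₂' ⊆ K₁ ∪ K₂ ∪ K₃`, `K₄' ⊆ K₄ ∪ K₃`, and
`K₄' ⊆ K₄` if `s(w,u) ∉ K₄`.  (Level 0 of Fig. 12: `o = 0`, `u = b̲₀`; level 1: `(o,u,w,z) = (x,z,t,v)`.)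
[folklore] -/
theorem exists_reroute_openConn {o u w z : V} {K₁ K₂ K₃ K₄ : Set (Sym2 V)}
    (hK₁ : K₁ ∈ (openConn o u : Set (BondConfig V))) (hK₂ : K₂ ∈ (openConn o w : Set (BondConfig V)))
    (hK₃ : K₃ ∈ (openConn w u : Set (BondConfig V))) (hK₄ : K₄ ∈ (openConn w z : Set (BondConfig V)))
    (d₁₂ : Disjoint K₁ K₂) (d₁₃ : Disjoint K₁ K₃) (d₁₄ : Disjoint K₁ K₄) (d₂₃ : Disjoint K₂ K₃)
    (d₂₄ : Disjoint K₂ K₄) (d₃₄ : Disjoint K₃ K₄) :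
    ∃ K₁' K₂' K₄' : Set (Sym2 V),
      K₁' ⊆ K₁ ∪ K₂ ∪ K₃ ∧ K₂' ⊆ K₁ ∪ K₂ ∪ K₃ ∧ K₄' ⊆ K₄ ∪ K₃ ∧ (s(w, u) ∉ K₄ → K₄' ⊆ K₄) ∧
      K₁' ∈ (openConn o u : Set (BondConfig V)) ∧ K₂' ∈ (openConn o w : Set (BondConfig V)) ∧
      K₄' ∈ (openConn w z : Set (BondConfig V)) ∧
      s(w, u) ∉ K₁' ∧ s(w, u) ∉ K₂' ∧ s(w, u) ∉ K₄' ∧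
      Disjoint K₁' K₂' ∧ Disjoint K₁' K₄' ∧ Disjoint K₂' K₄' := by
  classical
  set Ω : BondConfig V := K₁ ∪ K₂ ∪ K₃ ∪ K₄ with hΩ
  obtain ⟨W₁⟩ := hK₁
  obtain ⟨W₂⟩ := hK₂
  obtain ⟨W₃⟩ := hK₃
  obtain ⟨W₄⟩ := hK₄
  obtain ⟨P₁, hP₁, -⟩ := exists_walk_openGraph_of_subset (show K₁ ⊆ Ω by intro e he; simp [hΩ, he]) W₁
  obtain ⟨P₂, hP₂, -⟩ := exists_walk_openGraph_of_subset (show K₂ ⊆ Ω by intro e he; simp [hΩ, he]) W₂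
  obtain ⟨P₃, hP₃, -⟩ := exists_walk_openGraph_of_subset (show K₃ ⊆ Ω by intro e he; simp [hΩ, he]) W₃
  obtain ⟨P₄, hP₄, -⟩ := exists_walk_openGraph_of_subset (show K₄ ⊆ Ω by intro e he; simp [hΩ, he]) W₄
  -- edges of `Pᵢ` lie in `Kᵢ`
  have m₁ : ∀ e ∈ P₁.edges, e ∈ K₁ := fun e he => mem_of_mem_walk_edges W₁ (hP₁ ▸ he)
  have m₂ : ∀ e ∈ P₂.edges, e ∈ K₂ := fun e he => mem_of_mem_walk_edges W₂ (hP₂ ▸ he)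
  have m₃ : ∀ e ∈ P₃.edges, e ∈ K₃ := fun e he => mem_of_mem_walk_edges W₃ (hP₃ ▸ he)
  have m₄ : ∀ e ∈ P₄.edges, e ∈ K₄ := fun e he => mem_of_mem_walk_edges W₄ (hP₄ ▸ he)
  have dj : ∀ {A B : Set (Sym2 V)} {a b a' b' : V} (P : (openGraph Ω).Walk a b) (P' : (openGraph Ω).Walk a' b'),
      (∀ e ∈ P.edges, e ∈ A) → (∀ e ∈ P'.edges, e ∈ B) → Disjoint A B → List.Disjoint P.edges P'.edges :=
    fun P P' hA hB hAB e he he' => Set.disjoint_left.1 hAB (hA e he) (hB e he')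
  obtain ⟨Q₁, Q₂, Q₄, hb₁, hb₂, hb₄, e₁₂, e₁₄, e₂₄, c₁, c₂, c₄, -, -, -, hfix⟩ :=
    LaceGraph.exists_reroute_onto_adj P₁ P₂ P₃ P₄ (dj P₁ P₂ m₁ m₂ d₁₂) (dj P₁ P₃ m₁ m₃ d₁₃)
      (dj P₁ P₄ m₁ m₄ d₁₄) (dj P₂ P₃ m₂ m₃ d₂₃) (dj P₂ P₄ m₂ m₄ d₂₄) (dj P₃ P₄ m₃ m₄ d₃₄)
  have tri : ∀ e, (e ∈ P₁.edges ∨ e ∈ P₂.edges ∨ e ∈ P₃.edges) → e ∈ K₁ ∪ K₂ ∪ K₃ := by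
    rintro e (he | he | he)
    · exact Or.inl (Or.inl (m₁ e he))
    · exact Or.inl (Or.inr (m₂ e he))
    · exact Or.inr (m₃ e he)
  refine ⟨{e | e ∈ Q₁.edges}, {e | e ∈ Q₂.edges}, {e | e ∈ Q₄.edges}, fun e he => tri e (c₁ e he),
    fun e he => tri e (c₂ e he), ?_, fun hK e he => ?_, edgesSet_mem_openConn Q₁, edgesSet_mem_openConn Q₂,
    edgesSet_mem_openConn Q₄, hb₁, hb₂, hb₄, disjoint_edgesSet_of_disjoint Q₁ Q₂ e₁₂,
    disjoint_edgesSet_of_disjoint Q₁ Q₄ e₁₄, disjoint_edgesSet_of_disjoint Q₂ Q₄ e₂₄⟩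
  · rintro e he
    rcases c₄ e he with h' | h'
    · exact Or.inl (m₄ e h')
    · exact Or.inr (m₃ e h')
  · have hP : s(w, u) ∉ P₄.edges := fun h => hK (m₄ _ h)
    rw [hfix hP] at he
    exact m₄ e he

end Reroute

/-! ### The coding form (level `0`: `LaceCoding₀`; level `1`: `LaceCoding`) -/

section Coding

open Literature.Barriers.CriticalPhenomena Literature.Probability.Percolation
open Literature.Probability.LatticeModels Literature.Combinatorics.SimpleGraph _root_.SimpleGraph

variable {d : ℕ}

/-- The one-bond walk has exactly one edge. [folklore] -/
theorem edges_cons_nil {V : Type*} {G : _root_.SimpleGraph V} {a b : V} (h : G.Adj a b) :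
    (Walk.cons h (Walk.nil : G.Walk b b)).edges = [s(a, b)] := by
  rw [Walk.edges_cons, Walk.edges_nil]

/-- **Level `0`, class `a = 1`: the line `{w₀ ↔ b̲₀}` may be witnessed by the bond itself** ([FvdH17] §6.1,
proof of Lemma 5.2, Case `a = 1`, (6.7); Case `a = 1, b = 0`, (6.10)).  If the bond `{w, y}` (`y = b̲₀`, `w = w₀`,
`w ≠ y`) is open in `ω ∖ b₀`, a level-`0` coding can be replaced by one whose third walk is the one-bond walk
`w → y`, the two `0`-lines lying inside the old `0`-lines and the old `w–y` line, the pendant `w → z` inside the old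
pendant and the old `w–y` line and unchanged if it avoided the bond; the canonical clause `y = 0 → w = 0` is kept.
[folklore] -/
theorem LaceCoding₀.exists_reroute {ω : BondConfig (Site d)} {y y' w z : Site d} (c : LaceCoding₀ ω y y' w z)
    (hwy : w ≠ y) (hb : s(w, y) ∈ ω \ {s(y, y')}) :
    ∃ (h : (openGraph (ω \ {s(y, y')})).Adj w y) (c' : LaceCoding₀ ω y y' w z),
      c'.W₃ = Walk.cons h Walk.nil ∧
      (∀ e, e ∈ c'.W₁.edges ∨ e ∈ c'.W₂.edges → e ∈ c.W₁.edges ∨ e ∈ c.W₂.edges ∨ e ∈ c.W₃.edges) ∧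
      (∀ e ∈ c'.W₄.edges, e ∈ c.W₄.edges ∨ e ∈ c.W₃.edges) ∧
      (∀ x, x ∈ c'.W₁.support ∨ x ∈ c'.W₂.support → x ∈ c.W₁.support ∨ x ∈ c.W₂.support ∨ x ∈ c.W₃.support) ∧
      (∀ x ∈ c'.W₄.support, x ∈ c.W₄.support ∨ x ∈ c.W₃.support) ∧
      (s(w, y) ∉ c.W₄.edges → c'.W₄ = c.W₄) := by
  have hadj : (openGraph (ω \ {s(y, y')})).Adj w y := (openGraph_adj _ w y).2 ⟨hb, hwy⟩
  obtain ⟨Q₁, Q₂, Q₄, hb₁, hb₂, hb₄, e₁₂, e₁₄, e₂₄, c₁, c₂, c₄, s₁, s₂, s₄, hfix⟩ :=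
    LaceGraph.exists_reroute_onto_adj c.W₁ c.W₂ c.W₃ c.W₄ c.d₁₂ c.d₁₃ c.d₁₄ c.d₂₃ c.d₂₄ c.d₃₄
  have hQ₁ : List.Disjoint Q₁.edges (Walk.cons hadj (Walk.nil : (openGraph (ω \ {s(y, y')})).Walk y y)).edges := by
    intro e he he'
    rw [edges_cons_nil, List.mem_singleton] at he'
    subst he'
    exact hb₁ he
  have hQ₂ : List.Disjoint Q₂.edges (Walk.cons hadj (Walk.nil : (openGraph (ω \ {s(y, y')})).Walk y y)).edges := by
    intro e he he'
    rw [edges_cons_nil, List.mem_singleton] at he'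
    subst he'
    exact hb₂ he
  have hQ₄ : List.Disjoint (Walk.cons hadj (Walk.nil : (openGraph (ω \ {s(y, y')})).Walk y y)).edges Q₄.edges := by
    intro e he he'
    rw [edges_cons_nil, List.mem_singleton] at he
    subst he
    exact hb₄ he'
  refine ⟨hadj, ⟨Q₁, Q₂, Walk.cons hadj Walk.nil, Q₄, e₁₂, hQ₁, e₁₄, hQ₂, e₂₄, hQ₄, c.canon⟩, rfl, ?_, c₄, ?_, s₄,
    hfix⟩
  · rintro e (he | he)
    · exact c₁ e he
    · exact c₂ e he
  · rintro x (hx | hx)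
    · exact s₁ x hx
    · exact s₂ x hx

/-- **Level `1`, class `b = 1`: the line `{t ↔ z}` may be witnessed by the bond itself** ([FvdH17] §6.1, proof
of Lemma 5.2, Case `a = 0, b = 1`, (6.12), and "When `a = 1` and/or `b = 1`, we include the information that
either `u, w` and/or `z, t` are neighbors into the definition of `Ā^{ι,a,b}`", v2 p. 59).  If `z ≠ t` and the bond
`{t, z}` is open, a level-`1` coding can be replaced by one whose second walk is the one-bond walk `t → z`, with
THE SAME first walk `W₁` (the bond is never on `W₁`: `z ∈ A` would force `z = t`), hence the same off-`A`
clause for `W₁`; the off-`A` clause of the bond walk holds because `t ∉ A` (`LaceCoding.start_notMem`); the two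
`x`-lines lie inside the old `W₂, W₃, W₄`; `z ∈ A` and the canonical clause are kept. [folklore] -/
theorem LaceCoding.exists_reroute {ω : BondConfig (Site d)} {A : Set (Site d)} {v x t z : Site d}
    (c : LaceCoding ω A v x t z) (hzt : z ≠ t) (hb : s(t, z) ∈ ω) :
    ∃ (h : (openGraph ω).Adj t z) (c' : LaceCoding ω A v x t z),
      c'.W₂ = Walk.cons h Walk.nil ∧ c'.W₁ = c.W₁ ∧
      (∀ e, e ∈ c'.W₃.edges ∨ e ∈ c'.W₄.edges → e ∈ c.W₂.edges ∨ e ∈ c.W₃.edges ∨ e ∈ c.W₄.edges) ∧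
      (∀ y, y ∈ c'.W₃.support ∨ y ∈ c'.W₄.support → y ∈ c.W₂.support ∨ y ∈ c.W₃.support ∨ y ∈ c.W₄.support) := by
  have hadj : (openGraph ω).Adj t z := (openGraph_adj _ t z).2 ⟨hb, fun h => hzt h.symm⟩
  have hzW₁ : s(t, z) ∉ c.W₁.edges := fun h =>
    hzt (c.free₁ z (c.W₁.snd_mem_support_of_mem_edges h) c.mem)
  obtain ⟨W₁', W₃', W₄', hb₁, hb₃, hb₄, e₁₃, e₁₄, e₃₄, -, c₃, c₄, -, s₃, s₄, hfix⟩ :=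
    LaceGraph.exists_reroute_onto_adj' c.W₁ c.W₂ c.W₃ c.W₄ c.d₁₂ c.d₁₃ c.d₁₄ c.d₂₃ c.d₂₄ c.d₃₄
  have hW : W₁' = c.W₁ := hfix hzW₁
  subst hW
  have hB₁ : List.Disjoint c.W₁.edges (Walk.cons hadj (Walk.nil : (openGraph ω).Walk z z)).edges := by
    intro e he he'
    rw [edges_cons_nil, List.mem_singleton] at he'
    subst he'
    exact hb₁ he
  have hB₃ : List.Disjoint (Walk.cons hadj (Walk.nil : (openGraph ω).Walk z z)).edges W₃'.edges := by
    intro e he he'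
    rw [edges_cons_nil, List.mem_singleton] at he
    subst he
    exact hb₃ he'
  have hB₄ : List.Disjoint (Walk.cons hadj (Walk.nil : (openGraph ω).Walk z z)).edges W₄'.edges := by
    intro e he he'
    rw [edges_cons_nil, List.mem_singleton] at he
    subst he
    exact hb₄ he'
  have hfree : ∀ y ∈ (Walk.cons hadj (Walk.nil : (openGraph ω).Walk z z)).support, y ∈ A → y = z := by
    intro y hy hyA
    rw [Walk.support_cons, Walk.support_nil, List.mem_cons, List.mem_singleton] at hy
    rcases hy with rfl | rfl
    · exact absurd hyA (c.start_notMem hzt)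
    · rfl
  refine ⟨hadj, ⟨c.W₁, Walk.cons hadj Walk.nil, W₃', W₄', hB₁, e₁₃, e₁₄, hB₃, hB₄, e₃₄, c.mem, c.free₁, hfree,
    c.canon⟩, rfl, rfl, ?_, ?_⟩
  · rintro e (he | he)
    · exact c₃ e he
    · exact c₄ e he
  · rintro y (hy | hy)
    · exact s₃ y hy
    · exact s₄ y hy

end Coding

end Literature.Probability.FitznerVanDerHofstad2017
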